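import Summits.QuantumFields.YangMills.Theorems.UnitScaleTiltProp7LocalProjectorRowsRBOfCube
import Summits.QuantumFields.YangMills.Theorems.UnitScaleTiltProp7GramDifferenceNearRowMember
import HarnessLib

/-!
# Route `UnitScaleTilt`, crux K1 «MinimiserStabilityRegPr» (stmt-QuantumFields-19200), EX row `hGF[Lift]` (curved member) — LOD LINE, PEN (L5″) `hloc` PER CUBE,
# THE PER-CUBE DISCHARGE, STAGE OP: **THE GRAM ROW `hop` OF ✓`Prop7LocalProjectorRowCube.hloc_of_cube_rows` AT EVERY CUBE, FROM px5 g11's DOCK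
# ✓`Prop7GramDifferenceNearRowMember.norm_gram_apply_sub_le_near_member`** — for the cube-gauged background `W_c = (axialT U₀ c)·U₀` and every coarse vector `d_b`
# supported within `r` of `S_c`: `‖ι Q_1 G_1² T_1 ι d_b − ι Q_c G_c² T_c ι d_b‖ ≤ εN·‖ι d_b‖`, with `εN` an EXPLICIT function of `(L, K − n, c₀, c₁, a, ν, μa, Bt, Rb, ε₀)` only
# (`K`-free after the pin `c₁ = c₀ℓ³`: `O(ν)` cut-off commutator + `O(ε₀(Rb + L²))` flatness + the `e^{−μa(Bt−1)∕ν}` Agmon tail, times powers of `C_P² = max 2 (16c₀ℓ³∕(a c₁))`)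

Cell `ym3-torus` (HUMAN RULING D-0037: YM₃ on T³ is ladder rung R3 — NOT d = 4, NOT infinite volume, NOT a mass gap, NOT Clay).  Width seat `ym-routeR-w3` (gen 13); chair
★`ym-ust-19200-p1` g25 CHAIR WORD №2 (iii) «GO — routeR-w3 takes the per-cube discharge; default = all three rows»; px5 g11 ■ 04:50:44Z «per-cube discharge of `hop`∕`hRB1`∕`hRB2` =
routeR-w3 g13»; routeR-w2 g13 ✓p760402∕✓p760971 «USE BY NAME».  THEOREMS ONLY (0 `def`, 0 `sorry`); `--supports stmt-QuantumFields-19200 --as helper`, count-neutral.  HONEST LABEL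
(★★OWNER RULING №33 (6)): a knit of landed rows; CONDITIONAL on the per-cube letter families `Qc Tc Gc` and the flat letters `Q1 T1 G1` (px10 picks the data of record), `n < K`,
the smallness `24ε₀(Rb + 9) ≤ 1`, the no-wrap room, and the DISPLAYED window letters `hδw`∕`hwin` at `θa := μa·η`, `θa′ := 3μa` (routeR-w4 g27's δP-letters ∕ px10 v1.3's
window binders); nothing of `hloc`, `hlarge`, `hT`, `hGF`, EX or the crux is proved here.

THE KNIT (per cube centre `c`, inside the proof; the same as STAGE RB's).  `T₀ :=` the blocks within `r` of `S_c = {z | tdist z (B^k c) ≤ 3L^s + 4}` (so `supp d_b ⊆ T₀` by the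
row's hypothesis); cut-offs `χ χt χc φ φc` ← ✓p760971 `exists_cubeCutoffs` (rows (1)–(12)); fine radius `R := (Rb + 6)·L^k` ← ✓p761256 `tdist_le_of_cutoff_row` +
`tdist_blocks_T₀_le` under `3L^s + 4 + r + Bc∕ν + 3 ≤ Rb`; flatness `hUV` (`δ ≤ 2ε₀(Rb + 7)`) and `hflat` ← ✓`hUV_cubeGauge`∕`hflat_cubeGauge`, the block-flatness letter taken
as `δ′ := 6ε₀(Rb+9)∕m` (`m = max 1 (3(ℓ−1))`; admissible by ✓`deltaFlat_le_of_radius_le`, and then `8mδ′ = 48ε₀(Rb+9)`, `16mδ′ = 96ε₀(Rb+9)` EXACTLY — this is how `m`,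
hence `K`, leaves the constant); `χ = 1`, `φ = 0` above `supp d_b` ← row (7); massive rows at both backgrounds ← ✓`Prop7LocalProjectorRowsRBOfCube.coercive_of_massive`∕
`energy_of_massive`; `‖G‖ ≤ C_P²` ← ✓`norm_le_of_massive_eq`; the cut-off operators `X_χ`, `X_χt` ← ✓`exists_siteMul`; then ONE `exact` of px5's dock with `W := W_c`.

WHAT IS PROVED (ns `…Theorems.Prop7GramNearRowOfCube`).
* ★★★ `hop_of_cube` — ✓p760402's binder `hop` VERBATIM (`∀ c d_b, (supp d_b within r of S_c) → ‖ι(Q1(G1(G1(T1(ι d_b))))) − ι(Qc c (Gc c (Gc c (Tc c (ι d_b)))))‖ ≤ εN·‖ι d_b‖`),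
  `εN :=` px5's ✓`norm_gram_apply_sub_le_near_member` constant at `θ := ν·η, θ′ := 3ν, δ := 2ε₀(Rb+7), 16mδ′ := 96ε₀(Rb+9), 8mδ′ := 48ε₀(Rb+9), R := μa(Bt−1)∕ν,
  mW = m1 := (C_P²)⁻¹, ‖G_1‖, ‖G_c‖ ≤ C_P²` — printed in full in the statement.
HONEST SCOPE.  With STAGE RB (`hRB1_of_cube`, `hRB2_of_cube`) this completes the per-cube discharge of ✓p760402's three displayed px5-class rows; the window letters and
the choice of `(ν, μa, Bt, Bc, Rb, a)` against w2's budget are px10 v1.3's ∕ routeR-w4 g27's (δP-letters), not this file's.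

References: T. Bałaban, CMP **99** (1985) 389–434 [Balaban1985BackgroundPropagators] ((3.19) p.393, (3.24)–(3.26) pp.394–395, (3.49) p.399, (3.105)–(3.106) p.414);
CMP **99** (1985) 75–102 [Balaban1985RegularSpaces] (Lemma 1 p.79); CMP **98** (1985) 17–51 [Balaban1985Averaging] ((97) p.32).
-/

set_option autoImplicit false
noncomputable section

open scoped BigOperators Matrix.Norms.L2Operator InnerProductSpace ComplexConjugate Matrix

namespace Summit.QuantumFields.YangMills.Theorems.Prop7GramNearRowOfCube

open Literature.MathematicalPhysics.QuantumFieldTheory.Balaban1983to89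
open Literature.MathematicalPhysics.QuantumFieldTheory.Balaban1983to89.T3ContinuumYM3Torus
open T4Continuum BlockAveraging
open BlockAveraging (Idx)
open B7Prop1Explicit (disp)
open B5Eq118OneStroke (iterBlockOf iterBlock)
open B10Eq27TorusAxialLog (holT transl axialT)
open B7TransferAnalyticMean (meanCLM)
open B11Eq103H1Complex (SiteL2K)
open B3Taylor310LocalRemainder (tdist_self)
open Summit.QuantumFields.YangMills.Theorems.Prop8Chart (emlIterU)
open T3SectALandauChart (eta eta_pos bgUnits bgUnits_one)
open T3PrintedRegularMinimiser (RegPr regPr_one)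
open T3PrintedRegularOrbits (sites_eq regPr_gaugeAct_iff)
open T3RegularMinimiser (regThreshold regThreshold_pos)
open T3LevelShift (siteShift)
open Summit.QuantumFields.YangMills.Theorems.Prop7SectET3Transport (periodsT3)
open Summit.QuantumFields.YangMills.Theorems.Prop7SectET3HilbertLetters (W₂ toL2 toL2S DL2 DstarL2 covLapSite)
open Summit.QuantumFields.YangMills.Theorems.Prop7BlockDistanceWeights (eta_mul_pow_eq_one)
open Summit.QuantumFields.YangMills.Theorems.Prop7CubeCutoffGeometry (exists_cubeCutoffs)
open Summit.QuantumFields.YangMills.Theorems.Prop7CubeCutoffFlatness (tdist_le_of_cutoff_row tdist_blocks_T₀_le hUV_cubeGauge hflat_cubeGauge delta_le_of_radius_le deltaFlat_le_of_radius_le)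
open Summit.QuantumFields.YangMills.Theorems.Prop7GramDifferenceNearRowMember (norm_gram_apply_sub_le_near_member)
open Summit.QuantumFields.YangMills.Theorems.Prop7MassivePropagatorCoercive (exists_siteMul norm_le_of_massive_eq)
open Summit.QuantumFields.YangMills.Theorems.Prop7LocalProjectorRowsRBOfCube (coercive_of_massive energy_of_massive)
open Summit.QuantumFields.YangMills.Theorems.Prop7TopMeanFrameWalkLengths (one_le_frameWalkBound)

variable (F : T3Family) {n K : ℕ} (h : n ≤ K) {c₀ c₁ : ℝ} [Fact (0 < c₀)] [Fact (0 < c₁)]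

section OP

variable (hnK : n < K) {ε₀ : ℝ} (hε₀ : 0 < ε₀) (hε7 : 10 ^ 7 * (F.L : ℝ) ^ 3 * ε₀ ≤ 1)
  (U₀ : GaugeField (F.P K) 0 (Matrix.specialUnitaryGroup (Fin 2) ℂ)) (hreg : RegPr F n K ε₀ U₀)
  (ι : (Site (F.P K) (K - n) → Matrix (Fin 2) (Fin 2) ℂ) →ₗ[ℂ] SiteL2K ℂ 3 (periodsT3 F n) c₁ W₂)
  (hι : ∀ c, ι c = toL2S F n c₁ (fun z => c (siteShift (sites_eq F n K h) z)))
  {a : ℝ} (ha : 0 < a) (s : ℕ) {r : ℝ} (hr : 0 < r)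
  -- per-cube letters at the cube-gauged background
  (Qc : Site (F.P K) 0 → (SiteL2K ℂ 3 (periodsT3 F K) c₀ W₂ →ₗ[ℂ] (Site (F.P K) (K - n) → Matrix (Fin 2) (Fin 2) ℂ)))
  (hseqc : ∀ c : Site (F.P K) 0, (∀ lam : Site (F.P K) 0 → Matrix (Fin 2) (Fin 2) ℂ, ∃ ns : (j : ℕ) → Site (F.P K) j → Matrix (Fin 2) (Fin 2) ℂ, ns 0 = lam ∧
        (∀ (j : ℕ) (y : Site (F.P K) (j + 1)), ns (j + 1) y = ns j (emb y) - meanCLM (Idx (F.P K)) (Matrix (Fin 2) (Fin 2) ℂ) fun i : Idx (F.P K) =>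
          ns j (emb y) - ((holT (emlIterU j (bgUnits F K (GaugeField.gaugeAct (axialT U₀ c) U₀))) (emb y) (stairWord i.2.1 (off i.1)) : (Matrix (Fin 2) (Fin 2) ℂ)ˣ) : Matrix (Fin 2) (Fin 2) ℂ) *
            ns j (transl (emb y) (disp (stairWord i.2.1 (off i.1)))) * (((holT (emlIterU j (bgUnits F K (GaugeField.gaugeAct (axialT U₀ c) U₀))) (emb y) (stairWord i.2.1 (off i.1)))⁻¹ : (Matrix (Fin 2) (Fin 2) ℂ)ˣ) : Matrix (Fin 2) (Fin 2) ℂ)) ∧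
        ns (K - n) = Qc c (toL2S F K c₀ lam)))
  (Tc : Site (F.P K) 0 → (SiteL2K ℂ 3 (periodsT3 F n) c₁ W₂ →ₗ[ℂ] SiteL2K ℂ 3 (periodsT3 F K) c₀ W₂))
  (hTc : ∀ (c : Site (F.P K) 0) (l : SiteL2K ℂ 3 (periodsT3 F K) c₀ W₂) (f : SiteL2K ℂ 3 (periodsT3 F n) c₁ W₂), ⟪ι (Qc c l), f⟫_ℂ = ⟪l, Tc c f⟫_ℂ)
  (Gc : Site (F.P K) 0 → (SiteL2K ℂ 3 (periodsT3 F K) c₀ W₂ →ₗ[ℂ] SiteL2K ℂ 3 (periodsT3 F K) c₀ W₂))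
  (hAGc : ∀ (c : Site (F.P K) 0) (f : SiteL2K ℂ 3 (periodsT3 F K) c₀ W₂), covLapSite F n K c₀ (GaugeField.gaugeAct (axialT U₀ c) U₀) (Gc c f) + (a : ℂ) • Tc c (ι (Qc c (Gc c f))) = f)
  (hGAc : ∀ (c : Site (F.P K) 0) (w : SiteL2K ℂ 3 (periodsT3 F K) c₀ W₂), Gc c (covLapSite F n K c₀ (GaugeField.gaugeAct (axialT U₀ c) U₀) w + (a : ℂ) • Tc c (ι (Qc c w))) = w)
  -- the flat system at background `1`
  (Q1 : SiteL2K ℂ 3 (periodsT3 F K) c₀ W₂ →ₗ[ℂ] (Site (F.P K) (K - n) → Matrix (Fin 2) (Fin 2) ℂ))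
  (hseq₁ : (∀ lam : Site (F.P K) 0 → Matrix (Fin 2) (Fin 2) ℂ, ∃ ns : (j : ℕ) → Site (F.P K) j → Matrix (Fin 2) (Fin 2) ℂ, ns 0 = lam ∧
        (∀ (j : ℕ) (y : Site (F.P K) (j + 1)), ns (j + 1) y = ns j (emb y) - meanCLM (Idx (F.P K)) (Matrix (Fin 2) (Fin 2) ℂ) fun i : Idx (F.P K) =>
          ns j (emb y) - ((holT (emlIterU j (bgUnits F K (1 : GaugeField (F.P K) 0 (Matrix.specialUnitaryGroup (Fin 2) ℂ)))) (emb y) (stairWord i.2.1 (off i.1)) : (Matrix (Fin 2) (Fin 2) ℂ)ˣ) : Matrix (Fin 2) (Fin 2) ℂ) *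
            ns j (transl (emb y) (disp (stairWord i.2.1 (off i.1)))) * (((holT (emlIterU j (bgUnits F K (1 : GaugeField (F.P K) 0 (Matrix.specialUnitaryGroup (Fin 2) ℂ)))) (emb y) (stairWord i.2.1 (off i.1)))⁻¹ : (Matrix (Fin 2) (Fin 2) ℂ)ˣ) : Matrix (Fin 2) (Fin 2) ℂ)) ∧
        ns (K - n) = Q1 (toL2S F K c₀ lam)))
  (T1 : SiteL2K ℂ 3 (periodsT3 F n) c₁ W₂ →ₗ[ℂ] SiteL2K ℂ 3 (periodsT3 F K) c₀ W₂) (hT1 : ∀ (l : SiteL2K ℂ 3 (periodsT3 F K) c₀ W₂) (f : SiteL2K ℂ 3 (periodsT3 F n) c₁ W₂), ⟪ι (Q1 l), f⟫_ℂ = ⟪l, T1 f⟫_ℂ)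
  (G1 : SiteL2K ℂ 3 (periodsT3 F K) c₀ W₂ →ₗ[ℂ] SiteL2K ℂ 3 (periodsT3 F K) c₀ W₂)
  (hAG1 : ∀ f, covLapSite F n K c₀ (1 : GaugeField (F.P K) 0 (Matrix.specialUnitaryGroup (Fin 2) ℂ)) (G1 f) + (a : ℂ) • T1 (ι (Q1 (G1 f))) = f)
  (hGA1 : ∀ w, G1 (covLapSite F n K c₀ (1 : GaugeField (F.P K) 0 (Matrix.specialUnitaryGroup (Fin 2) ℂ)) w + (a : ℂ) • T1 (ι (Q1 w))) = w)
  -- cut-off parameters (routeR-w2 g13's ✓`exists_cubeCutoffs`), the coarse radius, the room, the smallness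
  {ν μa Bt Bc : ℝ} (hν : 0 < ν) (hμa : 0 ≤ μa) (hBt : 1 ≤ Bt) (hBc : Bt + 1 ≤ Bc)
  (Rb : ℕ) (hRb : 3 * (F.L : ℝ) ^ s + 4 + r + Bc / ν + 3 ≤ Rb)
  (hwrap : 2 * ((Rb + 9) * F.L ^ (K - n) + 2) ≤ (F.P K).sitesPerDir 0)
  (hεRb : 24 * ε₀ * ((Rb : ℝ) + 9) ≤ 1)

include h hε₀ hε7 hreg hι ha hr hseqc hTc hAGc hGAc hseq₁ hT1 hAG1 hGA1 hν hμa hBt hBc hRb hwrap hεRb in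
/-- ★★★ **THE GRAM ROW `hop` OF ✓p760402 `hloc_of_cube_rows`, AT EVERY CUBE** — for every coarse vector `d_b` supported within `r` of `S_c`:
`‖ι(Q_1(G_1(G_1(T_1(ι d_b))))) − ι(Q_c(G_c(G_c(T_c(ι d_b)))))‖ ≤ εN·‖ι d_b‖`, from px5's dock ✓`norm_gram_apply_sub_le_near_member` at `W := W_c`, the cube cut-offs of
✓`exists_cubeCutoffs` (`θ := ν·η`, `θ′ := 3ν`, Agmon `θa := μa·η`, `θa′ := 3μa`, `R := μa(Bt−1)∕ν`), the cube-gauge flatness `δ := 2ε₀(Rb+7)`, `8mδ′ := 48ε₀(Rb+9)` (STAGE G), the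
massive rows `mW = m1 := (C_P²)⁻¹` (STAGE RB §1) and `‖G_1‖, ‖G_c‖ ≤ C_P²`; the WINDOW `hδw`∕`hwin` (slope `μa`) DISPLAYED.  `εN` = `O(ν) + O(ε₀(Rb + L²)) +
O(e^{−μa(Bt−1)∕ν})` times powers of `C_P²` and of `κ = c₁∕(c₀ℓ³)` — `K`-free after the pin `c₁ = c₀ℓ³`, MONOTONE in `ε₀`.
[cite: Balaban1985BackgroundPropagators, (3.19) p.393, (3.24)–(3.26) pp.394–395, (3.49) p.399, (3.105)–(3.106) p.414; Balaban1985RegularSpaces, Lemma 1 p.79] -/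
theorem hop_of_cube {δ₁ : ℝ} (hδ₁ : 0 ≤ δ₁)
    (hδw : 3 * ((eta F n K)⁻¹) ^ 2 * (Real.exp (μa * eta F n K) - 1) ^ 2 + a * ((25 / 8) * (c₁ * ((((F.P K).L : ℝ) ^ (F.P K).d) ^ (K - n))⁻¹ / c₀)) * (Real.exp (3 * μa) - 1) ^ 2 ≤ δ₁ ^ 2)
    (hwin : Real.sqrt (max 2 (16 * c₀ * ((F.L : ℝ) ^ (K - n)) ^ 3 / (a * c₁))) * δ₁ ≤ 1 / 10) :
    ∀ (c : Site (F.P K) 0) (db : Site (F.P K) (K - n) → Matrix (Fin 2) (Fin 2) ℂ),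
      (∀ z, db z ≠ 0 → ∃ z' ∈ (Finset.univ.filter fun z : Site (F.P K) (K - n) => Site.tdist z (iterBlockOf (K - n) c) ≤ 3 * F.L ^ s + 4), (Site.tdist (P := F.P K) z' z : ℝ) < r) →
        ‖ι (Q1 (G1 (G1 (T1 (ι db))))) - ι (Qc c (Gc c (Gc c (Tc c (ι db)))))‖
          ≤ ((Real.sqrt (2 * (c₁ * ((((F.P K).L : ℝ) ^ (F.P K).d) ^ (K - n))⁻¹ / c₀)) * (2 * (4500 * (F.L : ℝ) ^ 2 * ε₀) + 96 * ε₀ * ((Rb : ℝ) + 9))) * ((max 2 (16 * c₀ * ((F.L : ℝ) ^ (K - n)) ^ 3 / (a * c₁))) ^ 2 * Real.sqrt ((25 / 8) * (c₁ * ((((F.P K).L : ℝ) ^ (F.P K).d) ^ (K - n))⁻¹ / c₀))) + (2 * Real.sqrt ((25 / 8) * (c₁ * ((((F.P K).L : ℝ) ^ (F.P K).d) ^ (K - n))⁻¹ / c₀))) * (Real.exp (-(μa * ((Bt - 1) / ν))) * (8 * Real.sqrt (max 2 (16 * c₀ * ((F.L : ℝ) ^ (K - n)) ^ 3 / (a *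 c₁))) ^ 2) ^ 2 * Real.sqrt ((25 / 8) * (c₁ * ((((F.P K).L : ℝ) ^ (F.P K).d) ^ (K - n))⁻¹ / c₀))) + Real.sqrt ((25 / 8) * (c₁ * ((((F.P K).L : ℝ) ^ (F.P K).d) ^ (K - n))⁻¹ / c₀)) * ((Real.sqrt (max 2 (16 * c₀ * ((F.L : ℝ) ^ (K - n)) ^ 3 / (a * c₁)))⁻¹⁻¹ * (1 + Real.sqrt (max 2 (16 * c₀ * ((F.L : ℝ) ^ (K - n)) ^ 3 / (a * c₁)))⁻¹⁻¹) * ((Real.sqrt 3 * (eta F n K)⁻¹ * (ν * eta F n K) + Real.sqrt 24 * (2 * ε₀ * ((Rb : ℝ) + 7)) + 2 * (Real.sqrt 3 * (eta F n K)⁻¹ * (ν * eta F n K)) * (Real.sqrt 24 * (2 * ε₀ * ((Rb : ℝ) + 7)))) * Real.sqrt (max 2 (16 * c₀ * ((F.L : ℝ) ^ (K - n)) ^ 3 / (a * c₁)))⁻¹⁻¹ + ((Real.sqrt 3 * (eta F n K)⁻¹ * (ν * eta F n K) + Real.sqrt 24 * (2 * ε₀ * ((Rb : ℝ) + 7)) +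 2 * (Real.sqrt 3 * (eta F n K)⁻¹ * (ν * eta F n K)) * (Real.sqrt 24 * (2 * ε₀ * ((Rb : ℝ) + 7)))) + a * ((25 / 4) * (c₁ * ((((F.P K).L : ℝ) ^ (F.P K).d) ^ (K - n))⁻¹ / c₀) * (3 * ν) + 2 * Real.sqrt ((25 / 8) * (c₁ * ((((F.P K).L : ℝ) ^ (F.P K).d) ^ (K - n))⁻¹ / c₀)) * (Real.sqrt (2 * (c₁ * ((((F.P K).L : ℝ) ^ (F.P K).d) ^ (K - n))⁻¹ / c₀)) * (2 * (4500 * (F.L : ℝ) ^ 2 * ε₀) + 2 * 0 + 2 * (48 * ε₀ * ((Rb : ℝ) + 9)))))) * (max 2 (16 * c₀ * ((F.L : ℝ) ^ (K - n)) ^ 3 / (a * c₁)))⁻¹⁻¹) + Real.sqrt (max 2 (16 * c₀ * ((F.L : ℝ) ^ (K - n)) ^ 3 / (a * c₁)))⁻¹⁻¹ * (1 + Real.sqrt (max 2 (16 * c₀ * ((F.L : ℝ) ^ (K - n)) ^ 3 / (a * c₁)))⁻¹⁻¹) * ((Real.sqrt 3 * (eta F n K)⁻¹ * (ν * eta F n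 K) + Real.sqrt 24 * (2 * ε₀ * ((Rb : ℝ) + 7)) + 2 * (Real.sqrt 3 * (eta F n K)⁻¹ * (ν * eta F n K)) * (Real.sqrt 24 * (2 * ε₀ * ((Rb : ℝ) + 7)))) * Real.sqrt (max 2 (16 * c₀ * ((F.L : ℝ) ^ (K - n)) ^ 3 / (a * c₁)))⁻¹⁻¹ + ((Real.sqrt 3 * (eta F n K)⁻¹ * (ν * eta F n K) + Real.sqrt 24 * (2 * ε₀ * ((Rb : ℝ) + 7)) + 2 * (Real.sqrt 3 * (eta F n K)⁻¹ * (ν * eta F n K)) * (Real.sqrt 24 * (2 * ε₀ * ((Rb : ℝ) + 7)))) + a * ((25 / 4) * (c₁ * ((((F.P K).L : ℝ) ^ (F.P K).d) ^ (K - n))⁻¹ / c₀) * (3 * ν) + 2 * Real.sqrt ((25 / 8) * (c₁ * ((((F.P K).L : ℝ) ^ (F.P K).d) ^ (K - n))⁻¹ / c₀)) * 0)) * (max 2 (16 * c₀ * ((F.L : ℝ) ^ (K - n)) ^ 3 / (a * c₁)))⁻¹⁻¹)) * ((max 2 (16 * c₀ * ((F.L : ℝ) ^ (K - n)) ^ 3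 / (a * c₁))) * Real.sqrt ((25 / 8) * (c₁ * ((((F.P K).L : ℝ) ^ (F.P K).d) ^ (K - n))⁻¹ / c₀)))
          + 2 * (max 2 (16 * c₀ * ((F.L : ℝ) ^ (K - n)) ^ 3 / (a * c₁))) * (Real.exp (-(μa * ((Bt - 1) / ν))) * (8 * Real.sqrt (max 2 (16 * c₀ * ((F.L : ℝ) ^ (K - n)) ^ 3 / (a * c₁))) ^ 2) * Real.sqrt ((25 / 8) * (c₁ * ((((F.P K).L : ℝ) ^ (F.P K).d) ^ (K - n))⁻¹ / c₀))) + (max 2 (16 * c₀ * ((F.L : ℝ) ^ (K - n)) ^ 3 / (a * c₁))) * ((Real.sqrt (max 2 (16 * c₀ * ((F.L : ℝ) ^ (K - n)) ^ 3 / (a * c₁)))⁻¹⁻¹ * (1 + Real.sqrt (max 2 (16 * c₀ * ((F.L : ℝ) ^ (K - n)) ^ 3 / (a * c₁)))⁻¹⁻¹) * ((Real.sqrt 3 * (eta F n K)⁻¹ * (ν * eta F n K) + Real.sqrt 24 * (2 * ε₀ * ((Rb : ℝ) + 7)) + 2 * (Real.sqrt 3 * (eta F n K)⁻¹ * (ν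 * eta F n K)) * (Real.sqrt 24 * (2 * ε₀ * ((Rb : ℝ) + 7)))) * Real.sqrt (max 2 (16 * c₀ * ((F.L : ℝ) ^ (K - n)) ^ 3 / (a * c₁)))⁻¹⁻¹ + ((Real.sqrt 3 * (eta F n K)⁻¹ * (ν * eta F n K) + Real.sqrt 24 * (2 * ε₀ * ((Rb : ℝ) + 7)) + 2 * (Real.sqrt 3 * (eta F n K)⁻¹ * (ν * eta F n K)) * (Real.sqrt 24 * (2 * ε₀ * ((Rb : ℝ) + 7)))) + a * ((25 / 4) * (c₁ * ((((F.P K).L : ℝ) ^ (F.P K).d) ^ (K - n))⁻¹ / c₀) * (3 * ν) + 2 * Real.sqrt ((25 / 8) * (c₁ * ((((F.P K).L : ℝ) ^ (F.P K).d) ^ (K - n))⁻¹ / c₀)) * (Real.sqrt (2 * (c₁ * ((((F.P K).L : ℝ) ^ (F.P K).d) ^ (K - n))⁻¹ / c₀)) * (2 * (4500 * (F.L : ℝ) ^ 2 * ε₀) + 2 * 0 + 2 * (48 * ε₀ * ((Rb : ℝ) + 9)))))) * (max 2 (16 * c₀ * ((F.L : ℝ) ^ (K - n)) ^ 3 / (a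 * c₁)))⁻¹⁻¹) + Real.sqrt (max 2 (16 * c₀ * ((F.L : ℝ) ^ (K - n)) ^ 3 / (a * c₁)))⁻¹⁻¹ * (1 + Real.sqrt (max 2 (16 * c₀ * ((F.L : ℝ) ^ (K - n)) ^ 3 / (a * c₁)))⁻¹⁻¹) * ((Real.sqrt 3 * (eta F n K)⁻¹ * (ν * eta F n K) + Real.sqrt 24 * (2 * ε₀ * ((Rb : ℝ) + 7)) + 2 * (Real.sqrt 3 * (eta F n K)⁻¹ * (ν * eta F n K)) * (Real.sqrt 24 * (2 * ε₀ * ((Rb : ℝ) + 7)))) * Real.sqrt (max 2 (16 * c₀ * ((F.L : ℝ) ^ (K - n)) ^ 3 / (a * c₁)))⁻¹⁻¹ + ((Real.sqrt 3 * (eta F n K)⁻¹ * (ν * eta F n K) + Real.sqrt 24 * (2 * ε₀ * ((Rb : ℝ) + 7)) + 2 * (Real.sqrt 3 * (eta F n K)⁻¹ * (ν * eta F n K)) * (Real.sqrt 24 * (2 * ε₀ * ((Rb : ℝ) + 7)))) + a * ((25 / 4) * (c₁ * ((((F.P K).L : ℝ) ^ (F.P K).d) ^ (K - n))⁻¹ /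 c₀) * (3 * ν) + 2 * Real.sqrt ((25 / 8) * (c₁ * ((((F.P K).L : ℝ) ^ (F.P K).d) ^ (K - n))⁻¹ / c₀)) * 0)) * (max 2 (16 * c₀ * ((F.L : ℝ) ^ (K - n)) ^ 3 / (a * c₁)))⁻¹⁻¹)) * Real.sqrt ((25 / 8) * (c₁ * ((((F.P K).L : ℝ) ^ (F.P K).d) ^ (K - n))⁻¹ / c₀)))
          + (max 2 (16 * c₀ * ((F.L : ℝ) ^ (K - n)) ^ 3 / (a * c₁))) ^ 2 * (Real.sqrt (2 * (c₁ * ((((F.P K).L : ℝ) ^ (F.P K).d) ^ (K - n))⁻¹ / c₀)) * (2 * (4500 * (F.L : ℝ) ^ 2 * ε₀) + 2 * 0 + 2 * (48 * ε₀ * ((Rb : ℝ) + 9)))))) * ‖ι db‖ := by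
  intro c db hdb
  classical
  have hc₀ : 0 < c₀ := Fact.out
  have hc₁ : 0 < c₁ := Fact.out
  have hη := eta_pos F n K
  have hL1 : 1 ≤ F.L ^ (K - n) := Nat.one_le_pow _ _ (by have := F.hL.2; omega)
  -- the two backgrounds are regular
  have hregW : RegPr F n K ε₀ (GaugeField.gaugeAct (axialT U₀ c) U₀) := (regPr_gaugeAct_iff F hε₀.le (axialT U₀ c) U₀).mpr hreg
  have hreg1 : RegPr F n K ε₀ (1 : GaugeField (F.P K) 0 (Matrix.specialUnitaryGroup (Fin 2) ℂ)) := regPr_one (F := F) (n := n) (K := K) hε₀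
  -- the coarse neighbourhood `T₀` of the cube and its cut-offs
  set S : Finset (Site (F.P K) (K - n)) := Finset.univ.filter fun z : Site (F.P K) (K - n) => Site.tdist z (iterBlockOf (K - n) c) ≤ 3 * F.L ^ s + 4 with hS
  set T₀ : Finset (Site (F.P K) (K - n)) := Finset.univ.filter fun z : Site (F.P K) (K - n) => ∃ z' ∈ S, (Site.tdist (P := F.P K) z' z : ℝ) < r with hT₀
  have hST : ∀ z ∈ S, z ∈ T₀ := fun z hz => by
    rw [hT₀, Finset.mem_filter]
    refine ⟨Finset.mem_univ _, z, hz, ?_⟩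
    rw [tdist_self]; exact_mod_cast hr
  have hcS : iterBlockOf (K - n) c ∈ S := by
    rw [hS, Finset.mem_filter]; exact ⟨Finset.mem_univ _, by rw [tdist_self]; exact Nat.zero_le _⟩
  have hT₀ne : T₀.Nonempty := ⟨_, hST _ hcS⟩
  have hdbT : ∀ z, db z ≠ 0 → z ∈ T₀ := fun z hz => by
    rw [hT₀, Finset.mem_filter]; exact ⟨Finset.mem_univ _, hdb z hz⟩
  obtain ⟨χ, χt, χc, φ, φc, h1, h2, h3, h4, h5, h6, h7, h8, h9, h10, h11, h12⟩ := exists_cubeCutoffs F h T₀ hT₀ne hν hμa hBt hBc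
  -- the fine radius of `supp χ`
  have hRT : ∀ y ∈ T₀, (Site.tdist (iterBlockOf (K - n) c) y : ℝ) ≤ 3 * (F.L : ℝ) ^ s + 4 + r := fun y hy => by
    rw [hT₀] at hy
    exact tdist_blocks_T₀_le F c s r y (Finset.mem_filter.mp hy).2
  have hR : ∀ x, χ x ≠ 0 → Site.tdist c x ≤ (Rb + 6) * F.L ^ (K - n) := by
    intro x hx
    have hreal := tdist_le_of_cutoff_row F h c T₀ hRT χ h12 x hx
    have hℓ : (1 : ℝ) ≤ (F.L : ℝ) ^ (K - n) := by exact_mod_cast hL1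
    have hℓ0 : (0 : ℝ) ≤ (F.L : ℝ) ^ (K - n) := by positivity
    have hbd : (F.L : ℝ) ^ (K - n) * (3 * (F.L : ℝ) ^ s + 4 + r + Bc / ν + 3) + 6 * ((F.L : ℝ) ^ (K - n) - 1) ≤ (((Rb + 6) * F.L ^ (K - n) : ℕ) : ℝ) := by
      push_cast
      nlinarith [mul_le_mul_of_nonneg_left hRb hℓ0]
    exact_mod_cast hreal.trans hbd
  have hwrap' : 2 * ((Rb + 6) * F.L ^ (K - n) + 3 * (F.L ^ (K - n) - 1) + 2) ≤ (F.P K).sitesPerDir 0 := by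
    have h3 : 3 * (F.L ^ (K - n) - 1) ≤ 3 * F.L ^ (K - n) := Nat.mul_le_mul_left _ (Nat.sub_le _ _)
    have : (Rb + 6) * F.L ^ (K - n) + 3 * (F.L ^ (K - n) - 1) + 2 ≤ (Rb + 9) * F.L ^ (K - n) + 2 := by nlinarith
    omega
  have hRreal : (((Rb + 6) * F.L ^ (K - n) : ℕ) : ℝ) ≤ (F.L : ℝ) ^ (K - n) * ((Rb : ℝ) + 6) := by push_cast; nlinarith
  -- flatness letters of the cube-gauged background on `supp χ` (STAGE G)
  have hUV : ∀ b : PBond (F.P K) 0, (χ b.tgt ≠ 0 ∨ χ b.src ≠ 0) →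
      ‖((bgUnits F K (GaugeField.gaugeAct (axialT U₀ c) U₀) b : (Matrix (Fin 2) (Fin 2) ℂ)ˣ) : Matrix (Fin 2) (Fin 2) ℂ) - ((bgUnits F K (1 : GaugeField (F.P K) 0 (Matrix.specialUnitaryGroup (Fin 2) ℂ)) b : (Matrix (Fin 2) (Fin 2) ℂ)ˣ) : Matrix (Fin 2) (Fin 2) ℂ)‖ ≤ (2 * ε₀ * ((Rb : ℝ) + 7)) * eta F n K := by
    intro b hb
    refine (hUV_cubeGauge F hε₀ U₀ hreg c χ hR hwrap' b hb).trans (mul_le_mul_of_nonneg_right ?_ hη.le)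
    have := delta_le_of_radius_le F (n := n) (K := K) hε₀ (R := (Rb + 6) * F.L ^ (K - n)) (R' := (Rb : ℝ) + 6) hRreal
    linarith
  have hδ'le : 2 * regThreshold F n K ε₀ * (((((Rb + 6) * F.L ^ (K - n) : ℕ) : ℝ)) + 3 * ((F.L : ℝ) ^ (K - n) - 1)) ≤ 2 * ε₀ * eta F n K * ((Rb : ℝ) + 9) := by
    have := deltaFlat_le_of_radius_le F (n := n) (K := K) hε₀ (R := (Rb + 6) * F.L ^ (K - n)) (R' := (Rb : ℝ) + 6) hRreal
    linarith
  have hflat := hflat_cubeGauge F hε₀ U₀ hreg c χ hR hwrap'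
  -- the block-flatness letter `δ′ := 6ε₀(Rb+9)∕m`: admissible, `4mδ′ ≤ 1`, and `8mδ′ = 48ε₀(Rb+9)`, `16mδ′ = 96ε₀(Rb+9)` exactly
  have hm1 := one_le_frameWalkBound F (n := n) (K := K)
  have hmpos : (0 : ℝ) < (((max 1 ((F.P K).d * ((F.P K).L ^ (K - n) - 1))) : ℕ) : ℝ) := by exact_mod_cast hm1
  have hmreal : (((max 1 ((F.P K).d * ((F.P K).L ^ (K - n) - 1))) : ℕ) : ℝ) ≤ 3 * (F.L : ℝ) ^ (K - n) := by
    have hd : (F.P K).d = 3 := rfl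
    have hL : (F.P K).L = F.L := rfl
    rw [hd, hL]
    have : max 1 (3 * (F.L ^ (K - n) - 1)) ≤ 3 * F.L ^ (K - n) := max_le (by omega) (Nat.mul_le_mul_left _ (Nat.sub_le _ _))
    exact_mod_cast this
  have hone := eta_mul_pow_eq_one F (n := n) (K := K)
  have hδ'0 : (0 : ℝ) ≤ 6 * ε₀ * ((Rb : ℝ) + 9) / (((max 1 ((F.P K).d * ((F.P K).L ^ (K - n) - 1))) : ℕ) : ℝ) := by positivity
  have h8m : 8 * (((max 1 ((F.P K).d * ((F.P K).L ^ (K - n) - 1))) : ℕ) : ℝ) * (6 * ε₀ * ((Rb : ℝ) + 9) / (((max 1 ((F.P K).d * ((F.P K).L ^ (K - n) - 1))) : ℕ) : ℝ))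
      = 48 * ε₀ * ((Rb : ℝ) + 9) := by
    field_simp
    ring
  have h16m : 16 * (((max 1 ((F.P K).d * ((F.P K).L ^ (K - n) - 1))) : ℕ) : ℝ) * (6 * ε₀ * ((Rb : ℝ) + 9) / (((max 1 ((F.P K).d * ((F.P K).L ^ (K - n) - 1))) : ℕ) : ℝ))
      = 96 * ε₀ * ((Rb : ℝ) + 9) := by
    field_simp
    ring
  have hmδ : 4 * (((max 1 ((F.P K).d * ((F.P K).L ^ (K - n) - 1))) : ℕ) : ℝ) * (6 * ε₀ * ((Rb : ℝ) + 9) / (((max 1 ((F.P K).d * ((F.P K).L ^ (K - n) - 1))) : ℕ) : ℝ)) ≤ 1 := by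
    have : 4 * (((max 1 ((F.P K).d * ((F.P K).L ^ (K - n) - 1))) : ℕ) : ℝ) * (6 * ε₀ * ((Rb : ℝ) + 9) / (((max 1 ((F.P K).d * ((F.P K).L ^ (K - n) - 1))) : ℕ) : ℝ))
        = 24 * ε₀ * ((Rb : ℝ) + 9) := by
      field_simp
      ring
    rw [this]; exact hεRb
  have hδ'real : 2 * regThreshold F n K ε₀ * (((((Rb + 6) * F.L ^ (K - n) : ℕ) : ℝ)) + 3 * ((F.L : ℝ) ^ (K - n) - 1))
      ≤ 6 * ε₀ * ((Rb : ℝ) + 9) / (((max 1 ((F.P K).d * ((F.P K).L ^ (K - n) - 1))) : ℕ) : ℝ) := by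
    rw [le_div_iff₀ hmpos]
    have hreg0 : 0 ≤ 2 * regThreshold F n K ε₀ * (((((Rb + 6) * F.L ^ (K - n) : ℕ) : ℝ)) + 3 * ((F.L : ℝ) ^ (K - n) - 1)) := by
      have := regThreshold_pos F (n := n) (K := K) hε₀
      have hℓ : (1 : ℝ) ≤ (F.L : ℝ) ^ (K - n) := by exact_mod_cast hL1
      have : (0 : ℝ) ≤ (F.L : ℝ) ^ (K - n) - 1 := by linarith
      positivity
    calc 2 * regThreshold F n K ε₀ * (((((Rb + 6) * F.L ^ (K - n) : ℕ) : ℝ)) + 3 * ((F.L : ℝ) ^ (K - n) - 1)) * (((max 1 ((F.P K).d * ((F.P K).L ^ (K - n) - 1))) : ℕ) : ℝ)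
        ≤ (2 * ε₀ * eta F n K * ((Rb : ℝ) + 9)) * (3 * (F.L : ℝ) ^ (K - n)) := mul_le_mul hδ'le hmreal hmpos.le (by positivity)
      _ = 6 * ε₀ * ((Rb : ℝ) + 9) * (eta F n K * (F.L : ℝ) ^ (K - n)) := by ring
      _ = 6 * ε₀ * ((Rb : ℝ) + 9) := by rw [hone, mul_one]
  have hflat' : ∀ Y : Site (F.P K) (K - n), (∃ x ∈ iterBlock (K - n) Y, χ x ≠ 0) → ∀ b : PBond (F.P K) 0,
      iterBlockOf (K - n) b.src = Y → iterBlockOf (K - n) b.tgt = Y →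
        ‖((bgUnits F K (GaugeField.gaugeAct (axialT U₀ c) U₀) b : (Matrix (Fin 2) (Fin 2) ℂ)ˣ) : Matrix (Fin 2) (Fin 2) ℂ) - 1‖
          ≤ 6 * ε₀ * ((Rb : ℝ) + 9) / (((max 1 ((F.P K).d * ((F.P K).L ^ (K - n) - 1))) : ℕ) : ℝ) :=
    fun Y hY b hs ht => (hflat Y hY b hs ht).trans hδ'real
  -- `χ = 1` and `φ = 0` above `supp d_b` (row (7))
  have hχN : ∀ x : Site (F.P K) 0, db (iterBlockOf (K - n) x) ≠ 0 → χ x = 1 := fun x hx => (h7 x (hdbT _ hx)).1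
  have hφN : ∀ x : Site (F.P K) 0, db (iterBlockOf (K - n) x) ≠ 0 → φ x = 0 := fun x hx => (h7 x (hdbT _ hx)).2.2
  -- the massive operators, their rows, the cut-off operators
  let AU : SiteL2K ℂ 3 (periodsT3 F K) c₀ W₂ →ₗ[ℂ] SiteL2K ℂ 3 (periodsT3 F K) c₀ W₂ := covLapSite F n K c₀ (GaugeField.gaugeAct (axialT U₀ c) U₀) + (a : ℂ) • (Tc c ∘ₗ ι ∘ₗ Qc c)
  have hAU : ∀ w, AU w = covLapSite F n K c₀ (GaugeField.gaugeAct (axialT U₀ c) U₀) w + (a : ℂ) • Tc c (ι (Qc c w)) := fun w => rfl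
  let AV : SiteL2K ℂ 3 (periodsT3 F K) c₀ W₂ →ₗ[ℂ] SiteL2K ℂ 3 (periodsT3 F K) c₀ W₂ := covLapSite F n K c₀ (1 : GaugeField (F.P K) 0 (Matrix.specialUnitaryGroup (Fin 2) ℂ)) + (a : ℂ) • (T1 ∘ₗ ι ∘ₗ Q1)
  have hAV : ∀ w, AV w = covLapSite F n K c₀ (1 : GaugeField (F.P K) 0 (Matrix.specialUnitaryGroup (Fin 2) ℂ)) w + (a : ℂ) • T1 (ι (Q1 w)) := fun w => rfl
  have hUG : ∀ v, AU (Gc c v) = v := fun v => by rw [hAU]; exact hAGc c v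
  have hGA : ∀ v, Gc c (AU v) = v := fun v => by rw [hAU]; exact hGAc c v
  have hAG : ∀ v, AV (G1 v) = v := fun v => by rw [hAV]; exact hAG1 v
  have hGAV : ∀ v, G1 (AV v) = v := fun v => by rw [hAV]; exact hGA1 v
  have hmU : (0 : ℝ) < (max 2 (16 * c₀ * ((F.L : ℝ) ^ (K - n)) ^ 3 / (a * c₁)))⁻¹ := inv_pos.mpr (lt_of_lt_of_le (by norm_num) (le_max_left _ _))
  have hC0 : (0 : ℝ) ≤ (max 2 (16 * c₀ * ((F.L : ℝ) ^ (K - n)) ^ 3 / (a * c₁))) := le_trans (by norm_num) (le_max_left _ _)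
  have hcoU := coercive_of_massive F h hε₀ hε7 (GaugeField.gaugeAct (axialT U₀ c) U₀) hregW (Qc c) (hseqc c) ι hι (Tc c) (hTc c) ha AU hAU
  have hcoV := coercive_of_massive F h hε₀ hε7 (1 : GaugeField (F.P K) 0 (Matrix.specialUnitaryGroup (Fin 2) ℂ)) hreg1 Q1 hseq₁ ι hι T1 hT1 ha AV hAV
  have henergyU := energy_of_massive F (GaugeField.gaugeAct (axialT U₀ c) U₀) (Qc c) ι (Tc c) (hTc c) AU hAU ha.le
  have henergyV := energy_of_massive F (1 : GaugeField (F.P K) 0 (Matrix.specialUnitaryGroup (Fin 2) ℂ)) Q1 ι T1 hT1 AV hAV ha.le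
  have hG1n : ∀ v, ‖G1 v‖ ≤ (max 2 (16 * c₀ * ((F.L : ℝ) ^ (K - n)) ^ 3 / (a * c₁))) * ‖v‖ := fun v =>
    norm_le_of_massive_eq F h hε₀ hε7 (1 : GaugeField (F.P K) 0 (Matrix.specialUnitaryGroup (Fin 2) ℂ)) hreg1 Q1 hseq₁ ι hι T1 hT1 ha (G1 v) v (hAG1 v)
  have hGWn : ∀ v, ‖Gc c v‖ ≤ (max 2 (16 * c₀ * ((F.L : ℝ) ^ (K - n)) ^ 3 / (a * c₁))) * ‖v‖ := fun v =>
    norm_le_of_massive_eq F h hε₀ hε7 (GaugeField.gaugeAct (axialT U₀ c) U₀) hregW (Qc c) (hseqc c) ι hι (Tc c) (hTc c) ha (Gc c v) v (hAGc c v)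
  obtain ⟨Xop, hXop⟩ := exists_siteMul F (K := K) (c₀ := c₀) χ
  obtain ⟨Xt, hXt⟩ := exists_siteMul F (K := K) (c₀ := c₀) χt
  -- px5's dock
  have key := norm_gram_apply_sub_le_near_member F h hε₀ hε7 hreg1 Q1 hseq₁ ι hι T1 hT1 (GaugeField.gaugeAct (axialT U₀ c) U₀) hregW (Qc c) (hseqc c) (Tc c) (hTc c) ha
    χ χt χc (θ := ν * eta F n K) (θ' := 3 * ν) (δ := 2 * ε₀ * ((Rb : ℝ) + 7)) (by positivity) (by positivity) (by positivity) hδ'0 h1 h2 h3 h4 h5 h6 hmδ hUV hflat'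
    db hχN φ φc (θa := μa * eta F n K) (θa' := 3 * μa) (by positivity) h8 h9 hδ₁ hδw hwin (R := μa * ((Bt - 1) / ν)) h11 hφN
    Xop Xt hXop hXt AV AU G1 (Gc c) hAV hAU hUG hAG hGA hGAV hmU hmU hcoU hcoV henergyU henergyV hC0 hG1n hGWn
  rw [h16m, h8m] at key
  exact key

end OP

end Summit.QuantumFields.YangMills.Theorems.Prop7GramNearRowOfCube

end
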